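import Summits.ValiantsHypothesis.ValiantsHypothesis.Theorems.MonotoneRestorationOrbitRestorationQPGroupedTerms
import HarnessLib

/-!
# Route MonotoneRestoration — crux `OrbitRestorationQP` (stmt-ValiantsHypothesis-18293), line `depth-three-rung`:
# A_k PER LEVEL (uniform constant, granting the rank bound) and the grouped residue with FEW-TERM SYMMETRIC GROUPS

The landed stub A_k (`stub_sigmaPiSigmaKValue`, p594347) is a family statement with an existential constant; its engine
`SigmaPiSigmaK.level_data` (Structure Theorem S at a big level, granting the Saxena–Seshadhri rank bound
`depthThree_rankBound` BY NAME) is per level.  Combined with A₁ per level (`SymmetricTerms.qpOrbitRestorable_of_symmetricAffineProd`)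
this gives A_k PER LEVEL with a constant depending on `k, c` only, hence a fourth kind of restorable GROUP for the grouped
criterion of `…OrbitRestorationQPGroupedTerms.lean`: (K) at most `c` terms whose SUM is matrix-symmetric (the terms themselves
arbitrary).  All results of this file that use (K) are CONDITIONAL on the named Literature fact `depthThree_rankBound`
(Saxena–Seshadhri 2013, Thm 5; unproved in the tree), taken as an explicit hypothesis.

* `qpOrbitRestorable_of_fewTerms` — **A_k PER LEVEL** (granting the rank bound): for all `k, c` there is `c'` such that every
  matrix-symmetric `p = Σ_{i<k} C(a i) · Π (L i)` at level `n` (`|L i| ≤ n^c + c`, affine factors) is `QPOrbitRestorable c' n p`;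
* `qpOrbitRestorable_of_atMostTerms` — the same uniformly over all `k ≤ K`;
* `qpOrbitRestorable_of_groupedTerms₂` — **GROUPED TERMS RESTORE, four kinds** (T) tame & diagonally invariant, (S) matrix-symmetric
  terms, (B) matrix-symmetric & small box volume, (K) at most `c` terms & matrix-symmetric sum — granting the rank bound;
* `sigmaPiSigmaValue_of_rankBound_of_wildResidue₅` — **`depthThree_rankBound` ∧ (FOUR-KIND GROUPED RESIDUE) ⇒ A_∞** (verbatim).

Nothing here proves the stub; VP ≠ VNP is not touched. [folklore]

## References
* N. Saxena, C. Seshadhri, *From Sylvester–Gallai configurations to rank bounds*, J. ACM 60 (2013), Thm 5. [SaxenaSeshadhri2013]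
* Z. Karnin, A. Shpilka, *Reconstruction of generalized depth-3 arithmetic circuits with bounded top fan-in*, CCC 2009, §3. [KarninShpilka2009]
* A. Dawar, G. Wilsenach, *Symmetric arithmetic circuits*, ToC 21 (2025), §3.3. [DawarWilsenach2025]
-/

noncomputable section

open scoped Classical

-- `Summit.ValiantsHypothesis.ValiantsHypothesis.…` is the tree's single-conjunct layout (Sub = Summit).
set_option linter.dupNamespace false

namespace Summit.ValiantsHypothesis.ValiantsHypothesis.Theorems

namespace OrbitRestorationQPDepthThreeRung

namespace FewTerms

open MvPolynomial Equiv Finset Literature.Computability.AlgebraicComplexity Restorable SigmaKThresholds LevelStructure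
  SigmaPiSigmaK

variable {n : ℕ}

/-! ### A_k per level -/

/-- **A_k PER LEVEL, UNIFORM CONSTANT (granting the rank bound).**  For all `k, c` there is `c'` such that at every level `n`
every matrix-symmetric `p = Σ_{i<k} C(a i) · Π (L i)` with every `L i` a multiset of `≤ n^c + c` polynomials of total degree `≤ 1`
is `QPOrbitRestorable c' n p`.  Beyond `levelThreshold k c`: Structure Theorem S (`SigmaPiSigmaK.level_data`) writes
`p = Σ_j C(u j) · Π Lin_j · Q_j(U)` with matrix-symmetric affine products (A₁ per level) and univariate `Q_j` in the invariant
`U` (`Restorable.qpOrbitRestorable_aeval_U`); below it `Restorable.qpOrbitRestorable_of_invariant`.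
[cite: SaxenaSeshadhri2013, Theorem 5; KarninShpilka2009, §3; DawarWilsenach2025, §3.3] -/
theorem qpOrbitRestorable_of_fewTerms (hRB : depthThree_rankBound) (k c : ℕ) : ∃ c' : ℕ, ∀ (n : ℕ)
    (p : MvPolynomial (Fin n × Fin n) ℂ) (a : Fin k → ℂ) (L : Fin k → Multiset (MvPolynomial (Fin n × Fin n) ℂ)),
    (∀ i, ∀ ℓ ∈ L i, ℓ.totalDegree ≤ 1) → (∀ i, Multiset.card (L i) ≤ n ^ c + c) →
    p = ∑ i, MvPolynomial.C (a i) * (L i).prod →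
    (∀ σ τ : Perm (Fin n), rename (fun q : Fin n × Fin n => (σ q.1, τ q.2)) p = p) →
    QPOrbitRestorable c' n p := by
  obtain ⟨c₁, hc₁⟩ := SymmetricTerms.qpOrbitRestorable_of_symmetricAffineProd c
  set N₀ := levelThreshold k c with hN₀
  refine ⟨max (max c₁ 5 + 9) (N₀.factorial + 5), fun n p a L hdeg hcard hp hsym => ?_⟩
  by_cases hn : N₀ ≤ n
  · refine qpOrbitRestorable_mono (le_max_left _ _) ?_
    obtain ⟨u, Lin, Q, hLin1, hLin2, hLin3, hsum⟩ := level_data hRB k c n hn p hsym a L hdeg hcard hp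
    rw [hsum]
    refine ValueOrbit.qpOrbitRestorable_finset_sum (Finset.univ : Finset (Fin k))
      (fun j => MvPolynomial.C (u j) * (Lin j).prod * Polynomial.aeval (U n) (Q j)) fun j _ => ?_
    have h1 : QPOrbitRestorable (max c₁ 5) n (MvPolynomial.C 1 * (Lin j).prod) := by
      refine qpOrbitRestorable_mono (le_max_left _ _) (hc₁ n _ 1 (Lin j) (hLin1 j) (hLin2 j) rfl fun σ τ => ?_)
      rw [map_mul, MvPolynomial.rename_C, hLin3 j σ τ]
    rw [MvPolynomial.C_1, one_mul] at h1
    have h2 : QPOrbitRestorable (max c₁ 5) n (Polynomial.aeval (U n) (Q j)) :=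
      qpOrbitRestorable_mono (le_max_right _ _) (qpOrbitRestorable_aeval_U _)
    have h3 := ValueOrbit.qpOrbitRestorable_smul (u j) (ValueOrbit.qpOrbitRestorable_mul h1 h2)
    rw [← mul_assoc] at h3
    exact qpOrbitRestorable_mono (by omega) h3
  · have hlt : n < N₀ := not_le.1 hn
    refine qpOrbitRestorable_mono (le_max_right _ _) ?_
    exact qpOrbitRestorable_mono (Nat.add_le_add_right (Nat.factorial_le hlt.le) 5)
      (qpOrbitRestorable_of_invariant p (fun σ => ValueOrbit.ren_eq_of_matrixSymmetric hsym σ))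

/-- **A_{≤K} PER LEVEL** (granting the rank bound): one constant for all numbers of terms `k ≤ K`. [folklore] -/
theorem qpOrbitRestorable_of_atMostTerms (hRB : depthThree_rankBound) (K c : ℕ) : ∃ c' : ℕ, ∀ (n : ℕ)
    (p : MvPolynomial (Fin n × Fin n) ℂ) (k : ℕ), k ≤ K → ∀ (a : Fin k → ℂ)
    (L : Fin k → Multiset (MvPolynomial (Fin n × Fin n) ℂ)),
    (∀ i, ∀ ℓ ∈ L i, ℓ.totalDegree ≤ 1) → (∀ i, Multiset.card (L i) ≤ n ^ c + c) →
    p = ∑ i, MvPolynomial.C (a i) * (L i).prod →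
    (∀ σ τ : Perm (Fin n), rename (fun q : Fin n × Fin n => (σ q.1, τ q.2)) p = p) →
    QPOrbitRestorable c' n p := by
  have h := fun k => qpOrbitRestorable_of_fewTerms hRB k c
  choose C hC using h
  refine ⟨(Finset.range (K + 1)).sup C, fun n p k hk a L hdeg hcard hp hsym => ?_⟩
  exact qpOrbitRestorable_mono (Finset.le_sup (f := C) (Finset.mem_range.2 (Nat.lt_succ_of_le hk)))
    (hC k n p a L hdeg hcard hp hsym)

/-! ### Grouped terms, four kinds -/

/-- **GROUPED DEPTH-THREE REPRESENTATIONS RESTORE — four kinds** (granting the rank bound).  For every `c` there is `c'` such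
that `p = Σ_{i<k} C(a i) · Π (L i)` at level `n` (`|L i| ≤ n^c + c`, affine factors) is `QPOrbitRestorable c' n p` as soon as the
terms are partitioned (`g : Fin k → Fin m`) into groups each of which is
(T) diagonally invariant with all factor multisets tame (`≤ 2^((log₂ n + c)^c)` translates), or
(S) made of matrix-symmetric terms, or
(B) matrix-symmetric with total box volume `≤ n^c + c`, or
(K) of at most `c` terms with matrix-symmetric sum.
[folklore; cite: SaxenaSeshadhri2013, Theorem 5; DawarWilsenach2025, §3.3] -/
theorem qpOrbitRestorable_of_groupedTerms₂ (hRB : depthThree_rankBound) (c : ℕ) : ∃ c' : ℕ, ∀ (n : ℕ)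
    (p : MvPolynomial (Fin n × Fin n) ℂ) (k : ℕ) (a : Fin k → ℂ) (L : Fin k → Multiset (MvPolynomial (Fin n × Fin n) ℂ))
    (m : ℕ) (g : Fin k → Fin m),
    (∀ i, ∀ ℓ ∈ L i, ℓ.totalDegree ≤ 1) → (∀ i, Multiset.card (L i) ≤ n ^ c + c) →
    p = ∑ i, MvPolynomial.C (a i) * (L i).prod →
    (∀ j : Fin m,
      ((∀ σ : Perm (Fin n), ren σ (∑ i ∈ univ.filter (fun i => g i = j), MvPolynomial.C (a i) * (L i).prod) =
          ∑ i ∈ univ.filter (fun i => g i = j), MvPolynomial.C (a i) * (L i).prod) ∧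
        ∀ i, g i = j →
          (Set.range fun σ : Perm (Fin n) => (L i).map (ren σ)).ncard ≤ 2 ^ ((Nat.log 2 n + c) ^ c)) ∨
      (∀ i, g i = j → ∀ σ τ : Perm (Fin n), rename (fun q : Fin n × Fin n => (σ q.1, τ q.2))
          (MvPolynomial.C (a i) * (L i).prod) = MvPolynomial.C (a i) * (L i).prod) ∨
      ((∀ σ τ : Perm (Fin n), rename (fun q : Fin n × Fin n => (σ q.1, τ q.2))
          (∑ i ∈ univ.filter (fun i => g i = j), MvPolynomial.C (a i) * (L i).prod) =
          ∑ i ∈ univ.filter (fun i => g i = j), MvPolynomial.C (a i) * (L i).prod) ∧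
        (∑ i ∈ univ.filter (fun i => g i = j), ∏ ℓ ∈ (L i).toFinset, ((L i).count ℓ + 1)) ≤ n ^ c + c) ∨
      ((∀ σ τ : Perm (Fin n), rename (fun q : Fin n × Fin n => (σ q.1, τ q.2))
          (∑ i ∈ univ.filter (fun i => g i = j), MvPolynomial.C (a i) * (L i).prod) =
          ∑ i ∈ univ.filter (fun i => g i = j), MvPolynomial.C (a i) * (L i).prod) ∧
        (univ.filter (fun i => g i = j)).card ≤ c)) →
    QPOrbitRestorable c' n p := by
  obtain ⟨cS, hS⟩ := SymmetricTerms.qpOrbitRestorable_of_symmetricTerms c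
  obtain ⟨cB, hB⟩ := Residue.qpOrbitRestorable_of_smallBox c
  obtain ⟨cK, hK⟩ := qpOrbitRestorable_of_atMostTerms hRB c c
  refine ⟨max (max (2 * c + 7) cK) (max cS cB) + 3, fun n p k a L m g hdeg hcard hp hgrp => ?_⟩
  -- the group sums
  set G : Fin m → MvPolynomial (Fin n × Fin n) ℂ :=
    fun j => ∑ i ∈ univ.filter (fun i => g i = j), MvPolynomial.C (a i) * (L i).prod with hG
  have hpG : p = ∑ j, G j := by
    rw [hp, hG]
    exact (Finset.sum_fiberwise_of_maps_to (s := univ) (t := univ) (g := g) (fun i _ => mem_univ _)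
      (fun i => MvPolynomial.C (a i) * (L i).prod)).symm
  rw [hpG]
  refine ValueOrbit.qpOrbitRestorable_finset_sum (Finset.univ : Finset (Fin m)) G fun j _ => ?_
  -- one group: re-index its fibre by `Fin`
  let ι := {i : Fin k // g i = j}
  obtain ⟨a', L', hsum, hprop, hvol⟩ :=
    GroupedTerms.reindex_terms (n := n) (fun i : ι => a i.1) (fun i : ι => L i.1)
  have hGj : G j = ∑ i', MvPolynomial.C (a' i') * (L' i').prod := by
    rw [← hsum, hG]
    simp only
    rw [Finset.sum_subtype (univ.filter fun i => g i = j) (p := fun i => g i = j) (by simp)]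
  have hvolj : (∑ i ∈ univ.filter (fun i => g i = j), ∏ ℓ ∈ (L i).toFinset, ((L i).count ℓ + 1)) =
      ∑ i', ∏ ℓ ∈ (L' i').toFinset, ((L' i').count ℓ + 1) := by
    rw [← hvol, Finset.sum_subtype (univ.filter fun i => g i = j) (p := fun i => g i = j) (by simp)]
  have hcardι : Fintype.card ι = (univ.filter fun i => g i = j).card := by
    rw [Fintype.card_subtype]
  have hdeg' : ∀ i', ∀ ℓ ∈ L' i', ℓ.totalDegree ≤ 1 :=
    hprop (fun _ M => ∀ ℓ ∈ M, ℓ.totalDegree ≤ 1) fun i => hdeg i.1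
  have hcard' : ∀ i', Multiset.card (L' i') ≤ n ^ c + c :=
    hprop (fun _ M => Multiset.card M ≤ n ^ c + c) fun i => hcard i.1
  rcases hgrp j with ⟨hinv, htame⟩ | hsymm | ⟨hms, hbox⟩ | ⟨hms, hfew⟩
  · -- (T) tame group
    refine qpOrbitRestorable_mono ((le_max_left _ _).trans (le_max_left _ _)) ?_
    have horb' : ∀ i', (Set.range fun σ : Perm (Fin n) => (L' i').map (ren σ)).ncard ≤
        2 ^ ((Nat.log 2 n + c) ^ c) :=
      hprop (fun _ M => (Set.range fun σ : Perm (Fin n) => M.map (ren σ)).ncard ≤ 2 ^ ((Nat.log 2 n + c) ^ c))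
        fun i => htame i.1 i.2
    have hinv' : ∀ σ : Perm (Fin n), ren σ (G j) = G j := hinv
    exact TameStratum.qpOrbitRestorable_of_tameTerms c a' L' hdeg' hcard' horb' hGj hinv'
  · -- (S) matrix-symmetric terms
    refine qpOrbitRestorable_mono ((le_max_left _ _).trans (le_max_right _ _)) ?_
    have hsymm' : ∀ i', ∀ σ τ : Perm (Fin n), rename (fun q : Fin n × Fin n => (σ q.1, τ q.2))
        (MvPolynomial.C (a' i') * (L' i').prod) = MvPolynomial.C (a' i') * (L' i').prod :=
      hprop (fun x M => ∀ σ τ : Perm (Fin n), rename (fun q : Fin n × Fin n => (σ q.1, τ q.2))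
        (MvPolynomial.C x * M.prod) = MvPolynomial.C x * M.prod) fun i => hsymm i.1 i.2
    exact hS n (G j) _ a' L' hdeg' hcard' hGj hsymm'
  · -- (B) small box volume
    refine qpOrbitRestorable_mono ((le_max_right _ _).trans (le_max_right _ _)) ?_
    refine hB n (G j) hms ⟨_, a', L', hdeg', ?_, hGj⟩
    rw [← hvolj]
    exact hbox
  · -- (K) few terms, matrix-symmetric sum
    refine qpOrbitRestorable_mono ((le_max_right _ _).trans (le_max_left _ _)) ?_
    exact hK n (G j) (Fintype.card ι) (hcardι ▸ hfew) a' L' hdeg' hcard' hGj hms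

/-! ### The residue, carved four times (granting the rank bound) -/

/-- **`depthThree_rankBound` ∧ FOUR-KIND GROUPED RESIDUE ⇒ `A_∞`.**  Granting the Saxena–Seshadhri rank bound (named Literature
fact, hypothesis `hRB`), the registered stub `stub_sigmaPiSigmaValue` (conclusion verbatim) follows from the per-level statement
(`hW`) about matrix-symmetric `p ∈ PDClass 1 n c` admitting NO cheap depth-three representation whose terms partition into groups of the
kinds (T)/(S)/(B)/(K) of `qpOrbitRestorable_of_groupedTerms₂`.  CONDITIONAL on `depthThree_rankBound`.
[folklore; cite: SaxenaSeshadhri2013, Theorem 5] -/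
theorem sigmaPiSigmaValue_of_rankBound_of_wildResidue₅ (hRB : depthThree_rankBound)
    (hW : ∀ c : ℕ, ∃ c' : ℕ, ∀ (n : ℕ) (p : MvPolynomial (Fin n × Fin n) ℂ),
      (∀ σ τ : Perm (Fin n), rename (fun q : Fin n × Fin n => (σ q.1, τ q.2)) p = p) →
      PDClass (fun _ => 1) n c p →
      (¬ ∃ (k : ℕ) (a : Fin k → ℂ) (L : Fin k → Multiset (MvPolynomial (Fin n × Fin n) ℂ)) (m : ℕ)
          (g : Fin k → Fin m),
          (∀ i, ∀ ℓ ∈ L i, ℓ.totalDegree ≤ 1) ∧ (∀ i, Multiset.card (L i) ≤ n ^ c + c) ∧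
          p = ∑ i, MvPolynomial.C (a i) * (L i).prod ∧
          ∀ j : Fin m,
            ((∀ σ : Perm (Fin n), ren σ (∑ i ∈ univ.filter (fun i => g i = j), MvPolynomial.C (a i) * (L i).prod) =
                ∑ i ∈ univ.filter (fun i => g i = j), MvPolynomial.C (a i) * (L i).prod) ∧
              ∀ i, g i = j →
                (Set.range fun σ : Perm (Fin n) => (L i).map (ren σ)).ncard ≤ 2 ^ ((Nat.log 2 n + c) ^ c)) ∨
            (∀ i, g i = j → ∀ σ τ : Perm (Fin n), rename (fun q : Fin n × Fin n => (σ q.1, τ q.2))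
                (MvPolynomial.C (a i) * (L i).prod) = MvPolynomial.C (a i) * (L i).prod) ∨
            ((∀ σ τ : Perm (Fin n), rename (fun q : Fin n × Fin n => (σ q.1, τ q.2))
                (∑ i ∈ univ.filter (fun i => g i = j), MvPolynomial.C (a i) * (L i).prod) =
                ∑ i ∈ univ.filter (fun i => g i = j), MvPolynomial.C (a i) * (L i).prod) ∧
              (∑ i ∈ univ.filter (fun i => g i = j), ∏ ℓ ∈ (L i).toFinset, ((L i).count ℓ + 1)) ≤
                n ^ c + c) ∨
            ((∀ σ τ : Perm (Fin n), rename (fun q : Fin n × Fin n => (σ q.1, τ q.2))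
                (∑ i ∈ univ.filter (fun i => g i = j), MvPolynomial.C (a i) * (L i).prod) =
                ∑ i ∈ univ.filter (fun i => g i = j), MvPolynomial.C (a i) * (L i).prod) ∧
              (univ.filter (fun i => g i = j)).card ≤ c)) →
      QPOrbitRestorable c' n p) :
    ∀ f : (n : ℕ) → MvPolynomial (Fin n × Fin n) ℂ, IsMatrixSymmetric f →
      (∃ c : ℕ, ∀ n : ℕ, PDClass (fun _ => 1) n c (f n)) →
      ∃ c : ℕ, ∀ n : ℕ, QPOrbitRestorable c n (f n) := by
  rintro f hsym ⟨c, hc⟩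
  obtain ⟨cG, hG⟩ := qpOrbitRestorable_of_groupedTerms₂ hRB c
  obtain ⟨cW, hcW⟩ := hW c
  refine ⟨max cG cW, fun n => ?_⟩
  have hsym_n : ∀ σ τ : Perm (Fin n), rename (fun q : Fin n × Fin n => (σ q.1, τ q.2)) (f n) = f n :=
    fun σ τ => hsym n σ τ
  by_cases hg : ∃ (k : ℕ) (a : Fin k → ℂ) (L : Fin k → Multiset (MvPolynomial (Fin n × Fin n) ℂ)) (m : ℕ)
      (g : Fin k → Fin m),
      (∀ i, ∀ ℓ ∈ L i, ℓ.totalDegree ≤ 1) ∧ (∀ i, Multiset.card (L i) ≤ n ^ c + c) ∧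
      f n = ∑ i, MvPolynomial.C (a i) * (L i).prod ∧
      ∀ j : Fin m,
        ((∀ σ : Perm (Fin n), ren σ (∑ i ∈ univ.filter (fun i => g i = j), MvPolynomial.C (a i) * (L i).prod) =
            ∑ i ∈ univ.filter (fun i => g i = j), MvPolynomial.C (a i) * (L i).prod) ∧
          ∀ i, g i = j →
            (Set.range fun σ : Perm (Fin n) => (L i).map (ren σ)).ncard ≤ 2 ^ ((Nat.log 2 n + c) ^ c)) ∨
        (∀ i, g i = j → ∀ σ τ : Perm (Fin n), rename (fun q : Fin n × Fin n => (σ q.1, τ q.2))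
            (MvPolynomial.C (a i) * (L i).prod) = MvPolynomial.C (a i) * (L i).prod) ∨
        ((∀ σ τ : Perm (Fin n), rename (fun q : Fin n × Fin n => (σ q.1, τ q.2))
            (∑ i ∈ univ.filter (fun i => g i = j), MvPolynomial.C (a i) * (L i).prod) =
            ∑ i ∈ univ.filter (fun i => g i = j), MvPolynomial.C (a i) * (L i).prod) ∧
          (∑ i ∈ univ.filter (fun i => g i = j), ∏ ℓ ∈ (L i).toFinset, ((L i).count ℓ + 1)) ≤ n ^ c + c) ∨
        ((∀ σ τ : Perm (Fin n), rename (fun q : Fin n × Fin n => (σ q.1, τ q.2))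
            (∑ i ∈ univ.filter (fun i => g i = j), MvPolynomial.C (a i) * (L i).prod) =
            ∑ i ∈ univ.filter (fun i => g i = j), MvPolynomial.C (a i) * (L i).prod) ∧
          (univ.filter (fun i => g i = j)).card ≤ c)
  · obtain ⟨k, a, L, m, g, hdeg, hcard, hfn, hgrp⟩ := hg
    exact qpOrbitRestorable_mono (le_max_left _ _) (hG n (f n) k a L m g hdeg hcard hfn hgrp)
  · exact qpOrbitRestorable_mono (le_max_right _ _) (hcW n (f n) hsym_n (hc n) hg)

end FewTerms

end OrbitRestorationQPDepthThreeRung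

end Summit.ValiantsHypothesis.ValiantsHypothesis.Theorems

end
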